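import Literature.NumberTheory.GaloisRepresentations.ContinuousCohomologyConnecting
import HarnessLib

/-!
# Continuous `H²` of an inverse limit of discrete modules, I: towers, limit classes, surjectivity

Let `G` be a locally compact topological group and let the topological representation
`X : TopRep R G` be presented as the inverse limit `X = lim_{← i} X_i` of an `ℕ`-tower
`⋯ → X_{i+1} → X_i → ⋯ → X_0` of topological representations carrying the DISCRETE topology,
with surjective transition maps and jointly continuous actions (`DiscreteTowerPresentation X`:
the projections `X → X_i` are jointly injective, every compatible family lifts, and the topology
of `X` is the one induced by the projections — e.g. `X = ℤ_ℓ(1) = lim μ_{ℓ^i}`,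
`X = Ẑ(1) = lim μ_{n!}`, any finitely generated `ℤ_ℓ`-representation `T = lim T/ℓ^i`).

This file and its sequel prove the classical comparison of continuous cochain cohomology with
the inverse limit of the cohomologies of the finite levels, in degree `2`:

* here: the inverse limit `lim_{← i} H²(G, X_i)` as the group of compatible families
  (`limitClasses`), the comparison map `H²(G, X) → lim_{← i} H²(G, X_i)` (`toLimitClasses`), and
  its **surjectivity** (`toLimitClasses_surjective`): a compatible family of classes is represented
  by an on-the-nose compatible family of continuous inhomogeneous `2`-cocycles (successive
  correction by coboundaries of lifted `1`-cochains — a continuous `1`-cochain with values in a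
  discrete module lifts along a surjection), which glue to a continuous `2`-cocycle of `X`;
* sequel (`ContinuousCohomologyTowerLimitInjective.lean`): **injectivity** when the groups
  `H¹(G, X_i)` are finite (Mittag-Leffler), whence `H²(G, lim X_i) ≅ lim H²(G, X_i)`.

This is Neukirch–Schmidt–Wingberg, *Cohomology of Number Fields* (2nd ed. 2008), Thm. (2.7.5)
(exact sequence `0 → lim¹ H^{n-1}(G, A_i) → H^n_cts(G, lim A_i) → lim H^n(G, A_i) → 0`) and
Cor. (2.7.6), in degree `n = 2`, over Mathlib's `continuousCohomology` through the tree's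
element-level description of `H²` by continuous inhomogeneous cocycles (`ContinuousH2.lean`:
`twoCocycleClass`, `twoCocycleClass_surjective`, `twoCocycleClass_eq_zero_iff`;
`ContinuousCohomologyConnecting.lean`: `cohomologyMap f 2 [c] = [f ∘ c]`).  Also: Rubin,
*Euler Systems* (2000), App. B Prop. B.2.3; Tate, *Relations between K₂ and Galois cohomology*
(1976), §2.

## References

* J. Neukirch, A. Schmidt, K. Wingberg, *Cohomology of Number Fields*, 2nd ed. (2008), II §7,
  (2.7.5), (2.7.6). [NeukirchSchmidtWingberg2008]
* J.-P. Serre, *Galois Cohomology* (1997), I §2.2–2.3. [SerreGaloisCohomology1997]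
-/

noncomputable section

open CategoryTheory Function

universe u v

namespace Literature.NumberTheory.GaloisRepresentations

open TopRep ContRepresentation ContinuousCohomology

variable {R : Type u} [CommRing R] [TopologicalSpace R]
variable {G : Type v} [Group G] [TopologicalSpace G]

/-! ### Towers of discrete topological representations presenting a limit -/

/-- A **presentation of `X` as the inverse limit of an `ℕ`-tower of discrete topological
representations**: levels `obj i` (discrete topology, jointly continuous `G`-action), surjective
transition maps `tr i : obj (i+1) ⟶ obj i`, and a compatible cone of projections
`proj i : X ⟶ obj i` which is a limit cone of topological spaces (jointly injective, every
compatible family lifts, topology of `X` induced by the projections).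
Ref: Neukirch–Schmidt–Wingberg (2008), II §7 (`A = lim A_i`, `A_i` finite discrete).
[cite: NeukirchSchmidtWingberg2008, II §7 (2.7.5)] -/
structure DiscreteTowerPresentation (X : TopRep.{v} R G) where
  /-- the `i`-th level `X_i` -/
  obj : ℕ → TopRep.{v} R G
  /-- the transition map `X_{i+1} → X_i` -/
  tr : ∀ i, obj (i + 1) ⟶ obj i
  /-- the projection `X → X_i` -/
  proj : ∀ i, X ⟶ obj i
  /-- compatibility of the projections with the transition maps -/
  tr_proj : ∀ (i : ℕ) (x : X), (tr i).hom ((proj (i + 1)).hom x) = (proj i).hom x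
  /-- each level carries the discrete topology -/
  discrete : ∀ i, DiscreteTopology (obj i)
  /-- the action on each level is jointly continuous -/
  continuous_action : ∀ i, Continuous fun p : G × obj i => (obj i).ρ p.1 p.2
  /-- the transition maps are surjective -/
  tr_surjective : ∀ i, Surjective (tr i).hom
  /-- the projections are jointly injective -/
  proj_injective : ∀ x y : X, (∀ i, (proj i).hom x = (proj i).hom y) → x = y
  /-- every compatible family lifts to `X` -/
  proj_lift : ∀ s : ∀ i, obj i, (∀ i, (tr i).hom (s (i + 1)) = s i) →
    ∃ x : X, ∀ i, (proj i).hom x = s i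
  /-- the topology of `X` is induced by the projections -/
  isInducing : Topology.IsInducing fun (x : X) (i : ℕ) => (proj i).hom x

namespace DiscreteTowerPresentation

variable {X : TopRep.{v} R G} (P : DiscreteTowerPresentation X)

/-- A continuous map into `X` is determined by its projections.
[cite: NeukirchSchmidtWingberg2008, Thm (2.7.5)] -/
theorem continuousMap_ext {T : Type*} [TopologicalSpace T] {f g : C(T, X)}
    (h : ∀ i t, (P.proj i).hom (f t) = (P.proj i).hom (g t)) : f = g :=
  ContinuousMap.ext fun t => P.proj_injective _ _ fun i => h i t

/-- **Gluing**: a compatible family of continuous maps `T → X_i` is the family of projections of a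
(unique) continuous map `T → X`. [cite: NeukirchSchmidtWingberg2008, Thm (2.7.5)] -/
theorem exists_continuousMap_lift {T : Type*} [TopologicalSpace T] (f : ∀ i, C(T, P.obj i))
    (hf : ∀ i t, (P.tr i).hom (f (i + 1) t) = f i t) :
    ∃ F : C(T, X), ∀ i t, (P.proj i).hom (F t) = f i t := by
  choose F hF using fun t => P.proj_lift (fun i => f i t) fun i => hf i t
  refine ⟨⟨F, ?_⟩, fun i t => hF t i⟩
  rw [P.isInducing.continuous_iff]
  exact continuous_pi fun i => by
    simpa only [Function.comp_def, hF] using (f i).continuous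

/-- A continuous map into the discrete level `X_i` lifts along the surjection `X_{i+1} → X_i` to a
continuous map into `X_{i+1}`. [cite: NeukirchSchmidtWingberg2008, Thm (2.7.5)] -/
theorem exists_continuousMap_liftStep {T : Type*} [TopologicalSpace T] (i : ℕ)
    (e : C(T, P.obj i)) : ∃ e' : C(T, P.obj (i + 1)), ∀ t, (P.tr i).hom (e' t) = e t := by
  haveI := P.discrete i
  obtain ⟨s, hs⟩ := (P.tr_surjective i).hasRightInverse
  exact ⟨⟨fun t => s (e t), (continuous_of_discreteTopology (f := s)).comp e.continuous⟩,
    fun t => hs (e t)⟩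

end DiscreteTowerPresentation

/-! ### The coboundary of a continuous `1`-cochain (jointly continuous action) -/

section Coboundary

variable [IsTopologicalGroup G] (Y : TopRep.{v} R G) (hY : Continuous fun p : G × Y => Y.ρ p.1 p.2)

/-- The **inhomogeneous coboundary** `(∂b)(σ, τ) = σ b(τ) - b(στ) + b(σ)` of a continuous
`1`-cochain `b : G → Y`, as a continuous inhomogeneous `2`-cocycle, for a topological representation
`Y` whose action is jointly continuous (this is `ContinuousRep.twoCoboundary` of
`ContinuousCohomologyConnecting.lean` stated for a bare `TopRep` with the joint continuity as a
hypothesis: `inhomogeneousCoboundary_eq_twoCoboundary`).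
Ref: Serre, *Galois Cohomology*, I §2.2. [cite: SerreGaloisCohomology1997, I §2.2] -/
def inhomogeneousCoboundary (b : C(G, Y)) : contTwoCocycles Y :=
  ⟨⟨fun p => Y.ρ p.1 (b p.2) - b (p.1 * p.2) + b p.1,
    ((hY.comp (continuous_fst.prodMk (b.continuous.comp continuous_snd))).sub
      (b.continuous.comp (continuous_fst.mul continuous_snd))).add
      (b.continuous.comp continuous_fst)⟩, fun σ τ υ => by
    change Y.ρ σ (Y.ρ τ (b υ) - b (τ * υ) + b τ) + (Y.ρ σ (b (τ * υ)) - b (σ * (τ * υ)) + b σ) =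
      Y.ρ (σ * τ) (b υ) - b (σ * τ * υ) + b (σ * τ) + (Y.ρ σ (b τ) - b (σ * τ) + b σ)
    have hmul : Y.ρ (σ * τ) (b υ) = Y.ρ σ (Y.ρ τ (b υ)) := by
      rw [_root_.map_mul]; rfl
    rw [map_add, map_sub, hmul, mul_assoc]
    abel⟩

/-- Unfolding `inhomogeneousCoboundary`. [cite: SerreGaloisCohomology1997, I §2.2] -/
@[simp] theorem inhomogeneousCoboundary_apply (b : C(G, Y)) (σ τ : G) :
    (inhomogeneousCoboundary Y hY b).1 (σ, τ) = Y.ρ σ (b τ) - b (σ * τ) + b σ := rfl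

/-- For the topological representation of a `ContinuousRep`, `inhomogeneousCoboundary` is the tree's
`ContinuousRep.twoCoboundary`. [cite: SerreGaloisCohomology1997, I §2.2] -/
theorem inhomogeneousCoboundary_eq_twoCoboundary {M : Type v} [AddCommGroup M] [Module R M]
    [TopologicalSpace M] [IsTopologicalAddGroup M] [ContinuousSMul R M] (ρ : ContinuousRep G R M)
    (b : C(G, M)) :
    inhomogeneousCoboundary ρ.toTopRep ρ.continuous_smul b = ρ.twoCoboundary b :=
  Subtype.ext (ContinuousMap.ext fun _ => rfl)

variable [LocallyCompactSpace G]

/-- The class of a coboundary vanishes. [cite: SerreGaloisCohomology1997, I §2.2] -/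
theorem twoCocycleClass_inhomogeneousCoboundary (b : C(G, Y)) :
    twoCocycleClass Y (inhomogeneousCoboundary Y hY b) = 0 :=
  (twoCocycleClass_eq_zero_iff Y _).2 ⟨b, fun _ _ => rfl⟩

end Coboundary

/-! ### Push-forward of cocycles along a morphism of representations of the same group -/

section Push

variable [IsTopologicalGroup G] {Y Z : TopRep.{v} R G}

/-- The push-forward `f ∘ z` of a continuous `2`-cocycle along a morphism `f : Y ⟶ Z` of
topological representations of `G` (the compatible pair `(id_G, f)`, through the tree's
`resIdHom`). [cite: SerreGaloisCohomology1997, I §2.2] -/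
abbrev contTwoCocycles.push (f : Y ⟶ Z) (z : contTwoCocycles Y) : contTwoCocycles Z :=
  contTwoCocycles.pullback (ContinuousMonoidHom.id G) (resIdHom f) z

omit [IsTopologicalGroup G] in
/-- Unfolding `contTwoCocycles.push`. [cite: SerreGaloisCohomology1997, I §2.2] -/
theorem contTwoCocycles.push_apply (f : Y ⟶ Z) (z : contTwoCocycles Y) (σ τ : G) :
    (contTwoCocycles.push f z).1 (σ, τ) = f.hom (z.1 (σ, τ)) := rfl

omit [IsTopologicalGroup G] in
/-- Push-forward is additive. [cite: SerreGaloisCohomology1997, I §2.2] -/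
theorem contTwoCocycles.push_add (f : Y ⟶ Z) (z z' : contTwoCocycles Y) :
    contTwoCocycles.push f (z + z') = contTwoCocycles.push f z + contTwoCocycles.push f z' :=
  Subtype.ext (ContinuousMap.ext fun p => by
    obtain ⟨σ, τ⟩ := p
    change f.hom (z.1 (σ, τ) + z'.1 (σ, τ)) = f.hom (z.1 (σ, τ)) + f.hom (z'.1 (σ, τ))
    rw [map_add])

omit [IsTopologicalGroup G] in
/-- Push-forward respects subtraction. [cite: SerreGaloisCohomology1997, I §2.2] -/
theorem contTwoCocycles.push_sub (f : Y ⟶ Z) (z z' : contTwoCocycles Y) :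
    contTwoCocycles.push f (z - z') = contTwoCocycles.push f z - contTwoCocycles.push f z' :=
  Subtype.ext (ContinuousMap.ext fun p => by
    obtain ⟨σ, τ⟩ := p
    change f.hom (z.1 (σ, τ) - z'.1 (σ, τ)) = f.hom (z.1 (σ, τ)) - f.hom (z'.1 (σ, τ))
    rw [map_sub])

/-- Push-forward of a coboundary is the coboundary of the push-forward.
[cite: SerreGaloisCohomology1997, I §2.2] -/
theorem contTwoCocycles.push_inhomogeneousCoboundary (f : Y ⟶ Z)
    (hY : Continuous fun p : G × Y => Y.ρ p.1 p.2) (hZ : Continuous fun p : G × Z => Z.ρ p.1 p.2)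
    (b : C(G, Y)) :
    contTwoCocycles.push f (inhomogeneousCoboundary Y hY b) =
      inhomogeneousCoboundary Z hZ ((f.hom : C(Y, Z)).comp b) :=
  Subtype.ext (ContinuousMap.ext fun p => by
    obtain ⟨σ, τ⟩ := p
    change f.hom (Y.ρ σ (b τ) - b (σ * τ) + b σ) = Z.ρ σ (f.hom (b τ)) - f.hom (b (σ * τ)) + f.hom (b σ)
    rw [map_add, map_sub, TopRep.hom_comm_apply])

/-- `Hⁿ(f)` on elements is the continuous linear map underlying the tree's `cohomologyMap f n`;
unfolding. [cite: SerreGaloisCohomology1997, I §2.2] -/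
theorem cohomologyMap_hom_apply (f : Y ⟶ Z) (n : ℕ) (c : continuousCohomology n Y) :
    (cohomologyMap f n).hom c = cohomologyMap f n c := rfl

variable [LocallyCompactSpace G]

/-- **`H²(f)[z] = [f ∘ z]`** in the push-forward notation. [cite: SerreGaloisCohomology1997, I §2.2] -/
theorem cohomologyMap_hom_twoCocycleClass (f : Y ⟶ Z) (z : contTwoCocycles Y) :
    (cohomologyMap f 2).hom (twoCocycleClass Y z) = twoCocycleClass Z (contTwoCocycles.push f z) :=
  cohomologyMap_twoCocycleClass f z

end Push

/-! ### The inverse limit of the `H²(G, X_i)` and the comparison map -/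

namespace DiscreteTowerPresentation

variable [IsTopologicalGroup G] {X : TopRep.{v} R G} (P : DiscreteTowerPresentation X)

/-- **`lim_{← i} H²(G, X_i)`**: compatible families of classes along the maps `H²(X_{i+1}) → H²(X_i)`
induced by the transition maps (the tree's `cohomologyMap (tr i) 2`), as an additive subgroup of
`∏_i H²(G, X_i)`. Ref: Neukirch–Schmidt–Wingberg (2008), (2.7.5).
[cite: NeukirchSchmidtWingberg2008, Thm (2.7.5)] -/
def limitClasses : AddSubgroup (∀ i, continuousCohomology 2 (P.obj i)) where
  carrier := {c | ∀ i, (cohomologyMap (P.tr i) 2).hom (c (i + 1)) = c i}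
  zero_mem' i := by
    change (cohomologyMap (P.tr i) 2).hom 0 = 0
    exact map_zero _
  add_mem' {a b} ha hb i := by
    change (cohomologyMap (P.tr i) 2).hom (a (i + 1) + b (i + 1)) = a i + b i
    rw [map_add, ha i, hb i]
  neg_mem' {a} ha i := by
    change (cohomologyMap (P.tr i) 2).hom (-a (i + 1)) = -a i
    rw [map_neg, ha i]

/-- Membership in `limitClasses`. [cite: NeukirchSchmidtWingberg2008, Thm (2.7.5)] -/
theorem mem_limitClasses_iff (c : ∀ i, continuousCohomology 2 (P.obj i)) :
    c ∈ P.limitClasses ↔ ∀ i, (cohomologyMap (P.tr i) 2).hom (c (i + 1)) = c i :=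
  Iff.rfl

omit [IsTopologicalGroup G] in
/-- Projections of the push-forwards of a cocycle of `X` are compatible.
[cite: NeukirchSchmidtWingberg2008, Thm (2.7.5)] -/
theorem push_tr_push_proj (z : contTwoCocycles X) (i : ℕ) :
    contTwoCocycles.push (P.tr i) (contTwoCocycles.push (P.proj (i + 1)) z) =
      contTwoCocycles.push (P.proj i) z :=
  Subtype.ext (ContinuousMap.ext fun p => by
    obtain ⟨σ, τ⟩ := p
    simp only [contTwoCocycles.push_apply, P.tr_proj])

variable [LocallyCompactSpace G]

/-- **The comparison map `H²(G, X) → lim_{← i} H²(G, X_i)`**, `c ↦ (H²(proj_i) c)_i`.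
Ref: Neukirch–Schmidt–Wingberg (2008), (2.7.5). [cite: NeukirchSchmidtWingberg2008, Thm (2.7.5)] -/
def toLimitClasses : continuousCohomology 2 X →+ P.limitClasses where
  toFun c := ⟨fun i => (cohomologyMap (P.proj i) 2).hom c, fun i => by
    obtain ⟨z, rfl⟩ := twoCocycleClass_surjective X c
    change (cohomologyMap (P.tr i) 2).hom ((cohomologyMap (P.proj (i + 1)) 2).hom
      (twoCocycleClass X z)) = (cohomologyMap (P.proj i) 2).hom (twoCocycleClass X z)
    rw [cohomologyMap_hom_twoCocycleClass, cohomologyMap_hom_twoCocycleClass,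
      cohomologyMap_hom_twoCocycleClass, push_tr_push_proj]⟩
  map_zero' := Subtype.ext (funext fun i => map_zero _)
  map_add' c c' := Subtype.ext (funext fun i => map_add _ _ _)

/-- Components of `toLimitClasses`. [cite: NeukirchSchmidtWingberg2008, Thm (2.7.5)] -/
@[simp] theorem toLimitClasses_apply_coe (c : continuousCohomology 2 X) (i : ℕ) :
    (P.toLimitClasses c : ∀ i, continuousCohomology 2 (P.obj i)) i =
      (cohomologyMap (P.proj i) 2).hom c := rfl

/-- `toLimitClasses` on the class of a cocycle: the family of classes of its projections.
[cite: NeukirchSchmidtWingberg2008, Thm (2.7.5)] -/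
theorem toLimitClasses_twoCocycleClass (z : contTwoCocycles X) (i : ℕ) :
    (P.toLimitClasses (twoCocycleClass X z) : ∀ i, continuousCohomology 2 (P.obj i)) i =
      twoCocycleClass (P.obj i) (contTwoCocycles.push (P.proj i) z) :=
  cohomologyMap_hom_twoCocycleClass _ _

/-! ### Surjectivity: compatible classes come from compatible cocycles -/

/-- One correction step: given a cocycle `z` at level `i` and a cocycle `w` at level `i + 1` whose
class maps to the class of `z`, there is a cocycle at level `i + 1` with the same class as `w`
whose push-forward is `z` ON THE NOSE (subtract the coboundary of a lift of the `1`-cochain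
bounding `tr_i ∘ w - z`). [cite: NeukirchSchmidtWingberg2008, Thm (2.7.5)] -/
theorem exists_push_eq (i : ℕ) (z : contTwoCocycles (P.obj i)) (w : contTwoCocycles (P.obj (i + 1)))
    (h : (cohomologyMap (P.tr i) 2).hom (twoCocycleClass _ w) = twoCocycleClass _ z) :
    ∃ w' : contTwoCocycles (P.obj (i + 1)),
      twoCocycleClass _ w' = twoCocycleClass _ w ∧ contTwoCocycles.push (P.tr i) w' = z := by
  rw [cohomologyMap_hom_twoCocycleClass, ← sub_eq_zero, ← twoCocycleClass_sub,
    twoCocycleClass_eq_zero_iff] at h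
  obtain ⟨e, he⟩ := h
  obtain ⟨e', he'⟩ := P.exists_continuousMap_liftStep i e
  refine ⟨w - inhomogeneousCoboundary _ (P.continuous_action (i + 1)) e', ?_, ?_⟩
  · rw [twoCocycleClass_sub, twoCocycleClass_inhomogeneousCoboundary, sub_zero]
  · rw [contTwoCocycles.push_sub, contTwoCocycles.push_inhomogeneousCoboundary (P.tr i)
      (P.continuous_action (i + 1)) (P.continuous_action i)]
    refine Subtype.ext (ContinuousMap.ext fun p => ?_)
    obtain ⟨σ, τ⟩ := p
    have h1 := he σ τ
    change (contTwoCocycles.push (P.tr i) w).1 (σ, τ) - z.1 (σ, τ) = _ at h1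
    change (contTwoCocycles.push (P.tr i) w).1 (σ, τ) -
      ((P.obj i).ρ σ ((P.tr i).hom (e' τ)) - (P.tr i).hom (e' (σ * τ)) + (P.tr i).hom (e' σ)) =
      z.1 (σ, τ)
    rw [he', he', he', ← h1]
    abel

/-- A cocycle at level `i` representing the `i`-th class of a compatible family of classes (the
type carried through the recursion). [cite: NeukirchSchmidtWingberg2008, Thm (2.7.5)] -/
structure CompatibleCocycleAt (c : P.limitClasses) (i : ℕ) where
  /-- the cocycle at level `i` -/
  cocycle : contTwoCocycles (P.obj i)
  /-- it represents `c i` -/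
  class_eq : twoCocycleClass _ cocycle = (c : ∀ i, continuousCohomology 2 (P.obj i)) i

/-- The recursion step: a representative at level `i + 1` projecting onto a given representative at
level `i`. [cite: NeukirchSchmidtWingberg2008, Thm (2.7.5)] -/
theorem exists_step (c : P.limitClasses) (i : ℕ) (prev : P.CompatibleCocycleAt c i) :
    ∃ w' : contTwoCocycles (P.obj (i + 1)),
      twoCocycleClass _ w' = (c : ∀ i, continuousCohomology 2 (P.obj i)) (i + 1) ∧
        contTwoCocycles.push (P.tr i) w' = prev.cocycle := by
  obtain ⟨w, hw⟩ := twoCocycleClass_surjective (P.obj (i + 1))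
    ((c : ∀ i, continuousCohomology 2 (P.obj i)) (i + 1))
  have h : (cohomologyMap (P.tr i) 2).hom (twoCocycleClass _ w) = twoCocycleClass _ prev.cocycle := by
    rw [hw, prev.class_eq]; exact c.2 i
  obtain ⟨w', hw'c, hw'p⟩ := P.exists_push_eq i prev.cocycle w h
  exact ⟨w', hw'c.trans hw, hw'p⟩

/-- The recursion step as data. [cite: NeukirchSchmidtWingberg2008, Thm (2.7.5)] -/
def step (c : P.limitClasses) (i : ℕ) (prev : P.CompatibleCocycleAt c i) :
    P.CompatibleCocycleAt c (i + 1) :=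
  ⟨(P.exists_step c i prev).choose, (P.exists_step c i prev).choose_spec.1⟩

/-- The step projects onto the previous representative. [cite: NeukirchSchmidtWingberg2008, Thm (2.7.5)] -/
theorem push_step (c : P.limitClasses) (i : ℕ) (prev : P.CompatibleCocycleAt c i) :
    contTwoCocycles.push (P.tr i) (P.step c i prev).cocycle = prev.cocycle :=
  (P.exists_step c i prev).choose_spec.2

/-- Recursive construction of an on-the-nose compatible family of cocycles representing a
compatible family of classes. [cite: NeukirchSchmidtWingberg2008, Thm (2.7.5)] -/
def compatibleCocycles (c : P.limitClasses) : ∀ i : ℕ, P.CompatibleCocycleAt c i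
  | 0 => ⟨(twoCocycleClass_surjective (P.obj 0)
      ((c : ∀ i, continuousCohomology 2 (P.obj i)) 0)).choose,
      (twoCocycleClass_surjective (P.obj 0) ((c : ∀ i, continuousCohomology 2 (P.obj i)) 0)).choose_spec⟩
  | i + 1 => P.step c i (compatibleCocycles c i)

/-- The recursively constructed cocycles are compatible on the nose.
[cite: NeukirchSchmidtWingberg2008, Thm (2.7.5)] -/
theorem push_compatibleCocycles_succ (c : P.limitClasses) (i : ℕ) :
    contTwoCocycles.push (P.tr i) (P.compatibleCocycles c (i + 1)).cocycle =
      (P.compatibleCocycles c i).cocycle :=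
  P.push_step c i _

/-- **Surjectivity of `H²(G, lim X_i) → lim H²(G, X_i)`** for an `ℕ`-tower of discrete
representations with surjective transition maps (no finiteness needed): every compatible family
of classes is the family of projections of the class of a continuous `2`-cocycle of `X`.
Ref: Neukirch–Schmidt–Wingberg (2008), Thm. (2.7.5) (surjectivity of
`H^n_cts(G, lim A_i) → lim H^n(G, A_i)`). [cite: NeukirchSchmidtWingberg2008, Thm (2.7.5)] -/
theorem toLimitClasses_surjective : Surjective P.toLimitClasses := by
  intro c
  let z : ∀ i, contTwoCocycles (P.obj i) := fun i => (P.compatibleCocycles c i).cocycle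
  have hz : ∀ i (p : G × G), (P.tr i).hom ((z (i + 1)).1 p) = (z i).1 p := fun i p => by
    obtain ⟨σ, τ⟩ := p
    have h := P.push_compatibleCocycles_succ c i
    exact (congrArg (fun f : contTwoCocycles (P.obj i) => f.1 (σ, τ)) h :)
  obtain ⟨F, hF⟩ := P.exists_continuousMap_lift (fun i => (z i).1) hz
  have hFc : F ∈ contTwoCocycles X := by
    intro σ τ υ
    apply P.proj_injective
    intro i
    rw [map_add, map_add, TopRep.hom_comm_apply, hF, hF, hF, hF]
    exact (z i).2 σ τ υ
  refine ⟨twoCocycleClass X ⟨F, hFc⟩, Subtype.ext (funext fun i => ?_)⟩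
  rw [toLimitClasses_twoCocycleClass, ← (P.compatibleCocycles c i).class_eq]
  refine congrArg (twoCocycleClass (P.obj i)) (Subtype.ext (ContinuousMap.ext fun p => ?_))
  obtain ⟨σ, τ⟩ := p
  exact hF i (σ, τ)

end DiscreteTowerPresentation

end Literature.NumberTheory.GaloisRepresentations

end
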